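import Mathlib
import Literature.Barriers.ValiantsHypothesis.AlgebraicNaturalProofs
import Literature.Barriers.ValiantsHypothesis.ShiftedPartialsMonotone
import Literature.Computability.AlgebraicComplexity.ArithCircuitProofs
import Summits.ValiantsHypothesis.ValiantsHypothesis.Theorems.BarrierLeverDefinableEquationsPartialDerivativeWall

/-!
# Route BarrierLever — method wall #1b: shifted partial derivatives of ORDER ONE are saturated
# by the Fermat polynomial `x_1^D + ⋯ + x_n^D`, for every shift `τ ≤ D - 2`
# (crux `DefinableEquations` stmt-8745 / item `SingleSizeEquations` stmt-8749; val-np-p5 g11)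

The g10 chart (`…PartialDerivativeWall.lean`, `…PartialDerivativeWallShifted.lean`) walls the
method of partial derivatives (shift `τ = 0`, every order `e ≤ ⌊n/2⌋`) and the shifted method at
HIGH orders `⌊n/2⌋ ≤ e ≤ 2⌊n/2⌋` (every shift), both by the quadric power
`Q_n = (Σ x_i²)^{⌊n/2⌋}`, and names LOW orders `1 ≤ e < n/2` with `τ ≥ 1` — the
Gupta–Kamath–Kayal–Saptharishi regime — as the one classical rank method left unwalled.  This
file closes the bottom row of that gap, `e = 1`:

* `shiftedPartialsRank_one_le` — for EVERY `g ∈ K[x_1..x_n]` (any degree) and every shift `τ`,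
  `rank g_{(1,·)[τ]} ≤ n · #{monomials of degree τ}` (the span of `x^β ∂_i g` has that many
  generators);
* `card_le_shiftedPartialsRank_one_sumPow` — for the Fermat polynomial `F_D = Σ_j x_j^D` and
  `τ + 2 ≤ D` the generators `x^β · D x_i^{D-1}` are distinct monomials (a collision
  `β + (D-1)e_i = β' + (D-1)e_j` with `i ≠ j` forces `β_j ≥ D-1 > τ`), hence independent: the
  trivial ceiling is ATTAINED (`shiftedPartialsRank_one_sumPow_eq`);
* `shiftedPartialsRank_one_le_sumPow` — so `rank g_{(1,·)[τ]} ≤ rank (F_D)_{(1,·)[τ]}` for every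
  `g`; `totalDegree_sumPow_le`, `complexity_sumPow_le` (`≤ n·D + n`), `sumPow_mem_smallCircuits`
  (`F_{n-1} ∈ SmallCircuits ℂ n b` for `b ≥ 2`, `n ≥ 2`);
* **`no_shiftedRankMethod_smallCircuits_orderOne`** — for `n ≥ 3`, `b ≥ 2` and every shift
  `τ ≤ n - 3` there is NO threshold `r` with `rank f_{(1,·)[τ]} < r` on `SmallCircuits ℂ n b` and
  `rank g_{(1,·)[τ]} ≥ r` for some `g` — ANY `g`, homogeneous or not, of any degree (the largeness
  witness is unrestricted because the ceiling is universal); `sublevel_one_eq_univ_of_smallCircuits`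
  (a first-order threshold set containing the class is everything).

Scope, honestly: order `e = 1` only (first-order shifted partials = syzygies of the Jacobian
ideal: below the Koszul degree, shift `τ ≤ D - 2`, there are none for a smooth Fermat
hypersurface); shifts `τ ≥ n - 2` at order one (where Koszul syzygies make the ceiling
unattainable for every polynomial and the maximum is the complete-intersection value) and all
orders `2 ≤ e < ⌊n/2⌋` remain unwalled in the kernel — for those the val-np-p5 g11 census
(HOME/val-np-p5/LANDSCAPE-8749-g11.md) records NUMERICAL saturation by width-2 algebraic branching
programs and by three products of `n` linear forms at small `n` (the census of that memo).  WHAT THIS IS NOT: nothing here bears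
on the crux's verdict (b = 2 OPEN) or on `VP ≠ VNP`; a wall kills a rank THRESHOLD, not every
polynomial in the ideal of minors.  No definitions, no named facts; standard axioms.
-/

-- `Summit.ValiantsHypothesis.ValiantsHypothesis.…` repeats a component by the D-0017 layout
-- (single-conjunct summit), which the `dupNamespace` linter flags; the name is mandated.
set_option linter.dupNamespace false

noncomputable section

namespace Summit.ValiantsHypothesis.ValiantsHypothesis.Theorems.BarrierLeverDefinableEquations

open MvPolynomial
open Literature.Computability.AlgebraicComplexity
open Literature.Barriers.ValiantsHypothesis
open scoped BigOperators

namespace PartialDerivativeWall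

section OrderOne

variable {K : Type*} [Field K] {n : ℕ}

/-! ## §1 The universal ceiling at order one -/

/-- A list of length one is a singleton. [folklore] -/
theorem iterPDeriv_of_length_eq_one {l : List (Fin n)} (hl : l.length = 1) (g : MvPolynomial (Fin n) K) :
    ∃ i, iterPDeriv l g = pderiv i g := by
  obtain ⟨i, rfl⟩ := List.length_eq_one_iff.mp hl
  exact ⟨i, by simp⟩

/-- The order-one shifted partials of shift `τ` of ANY `g` are among the `n · #{deg-τ monomials}`
products `x^β ∂_i g`. [folklore] -/
theorem shiftedPartials_one_subset_range (τ : ℕ) (g : MvPolynomial (Fin n) K) :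
    shiftedPartials 1 τ g ⊆ Set.range (fun p : Fin n × ↥((Finset.univ : Finset (Fin n)).finsuppAntidiag τ) =>
      monomial (p.2 : Fin n →₀ ℕ) (1 : K) * pderiv p.1 g) := by
  classical
  rintro _ ⟨l, β, hl, hβ, rfl⟩
  obtain ⟨i, hi⟩ := iterPDeriv_of_length_eq_one hl g
  refine ⟨⟨i, ⟨β, (degree_eq_iff_mem_finsuppAntidiag β τ).mp hβ⟩⟩, ?_⟩
  simp [hi]

/-- **Ceiling at order one**: `rank g_{(1,·)[τ]} ≤ n · #{monomials of degree τ}` for every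
polynomial `g` in `n` variables (any degree). [cite: LandsbergGCT2017, §6.2.2 (p. 158)] -/
theorem shiftedPartialsRank_one_le (τ : ℕ) (g : MvPolynomial (Fin n) K) :
    shiftedPartialsRank K 1 τ g ≤ n * ((Finset.univ : Finset (Fin n)).finsuppAntidiag τ).card := by
  classical
  set φ := fun p : Fin n × ↥((Finset.univ : Finset (Fin n)).finsuppAntidiag τ) =>
      monomial (p.2 : Fin n →₀ ℕ) (1 : K) * pderiv p.1 g with hφ
  haveI : Module.Finite K (Submodule.span K (Set.range φ)) :=
    Module.Finite.span_of_finite K (Set.finite_range φ)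
  unfold shiftedPartialsRank
  calc Module.finrank K (Submodule.span K (shiftedPartials 1 τ g))
      ≤ Module.finrank K (Submodule.span K (Set.range φ)) :=
        Submodule.finrank_mono (Submodule.span_mono (shiftedPartials_one_subset_range τ g))
    _ ≤ Fintype.card (Fin n × ↥((Finset.univ : Finset (Fin n)).finsuppAntidiag τ)) :=
        finrank_range_le_card φ
    _ = n * ((Finset.univ : Finset (Fin n)).finsuppAntidiag τ).card := by
        rw [Fintype.card_prod, Fintype.card_fin, Fintype.card_coe]

/-! ## §2 The Fermat polynomial attains the ceiling for shifts `τ ≤ D - 2` -/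

/-- `∂_i (Σ_j x_j^D) = D · x_i^{D-1}` as a monomial. [folklore] -/
theorem pderiv_sumPow (D : ℕ) (i : Fin n) :
    pderiv i (∑ j : Fin n, (X j : MvPolynomial (Fin n) K) ^ D) =
      monomial (Finsupp.single i (D - 1)) (D : K) := by
  classical
  rw [map_sum]
  rw [Finset.sum_eq_single i]
  · rw [X_pow_eq_monomial, pderiv_monomial, Finsupp.single_apply, if_pos rfl, one_mul,
      ← Finsupp.single_tsub]
  · intro j _ hji
    rw [X_pow_eq_monomial, pderiv_monomial, Finsupp.single_apply, if_neg hji, Nat.cast_zero,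
      mul_zero, monomial_zero]
  · intro h; exact absurd (Finset.mem_univ i) h

/-- The generators `x^β ∂_i F_D = D · x^{β + (D-1)e_i}` of the order-one shifted partials of the
Fermat polynomial. [folklore] -/
theorem monomial_mul_pderiv_sumPow (D : ℕ) (i : Fin n) (β : Fin n →₀ ℕ) :
    monomial β (1 : K) * pderiv i (∑ j : Fin n, (X j : MvPolynomial (Fin n) K) ^ D) =
      monomial (β + Finsupp.single i (D - 1)) (D : K) := by
  rw [pderiv_sumPow, monomial_mul, one_mul]

/-- The exponents `β + (D-1)e_i`, `deg β = τ ≤ D - 2`, are pairwise distinct. [folklore] -/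
theorem injective_shiftExponent {D τ : ℕ} (hτ : τ + 2 ≤ D) :
    Function.Injective (fun p : Fin n × ↥((Finset.univ : Finset (Fin n)).finsuppAntidiag τ) =>
      (p.2 : Fin n →₀ ℕ) + Finsupp.single p.1 (D - 1)) := by
  classical
  rintro ⟨i, β, hβ⟩ ⟨j, β', hβ'⟩ h
  have hdeg : (β : Fin n →₀ ℕ).degree = τ := (degree_eq_iff_mem_finsuppAntidiag β τ).mpr hβ
  have hdeg' : (β' : Fin n →₀ ℕ).degree = τ := (degree_eq_iff_mem_finsuppAntidiag β' τ).mpr hβ'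
  by_cases hij : i = j
  · subst hij
    have hb : (β : Fin n →₀ ℕ) = β' := add_right_cancel h
    exact Prod.ext rfl (Subtype.ext hb)
  · exfalso
    have h1 : (β : Fin n →₀ ℕ) j = (β' : Fin n →₀ ℕ) j + (D - 1) := by
      have := congrArg (fun f : Fin n →₀ ℕ => f j) h
      simpa [Finsupp.single_apply, hij] using this
    have h2 : (β : Fin n →₀ ℕ) j ≤ τ := hdeg ▸ Finsupp.le_degree j (β : Fin n →₀ ℕ)
    omega

/-- The generators of the order-one shifted partials of `F_D` are linearly independent when
`τ + 2 ≤ D` (characteristic `0`: the coefficient `D` is a unit). [folklore] -/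
theorem linearIndependent_shifted_sumPow [CharZero K] {D τ : ℕ} (hτ : τ + 2 ≤ D) :
    LinearIndependent K (fun p : Fin n × ↥((Finset.univ : Finset (Fin n)).finsuppAntidiag τ) =>
      monomial (p.2 : Fin n →₀ ℕ) (1 : K) *
        pderiv p.1 (∑ j : Fin n, (X j : MvPolynomial (Fin n) K) ^ D)) := by
  classical
  have hD : (D : K) ≠ 0 := by exact_mod_cast (show D ≠ 0 by omega)
  -- distinct monic monomials are independent; multiply by the nonzero constant `D`
  have hb : LinearIndependent K (fun p : Fin n × ↥((Finset.univ : Finset (Fin n)).finsuppAntidiag τ) =>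
      monomial ((p.2 : Fin n →₀ ℕ) + Finsupp.single p.1 (D - 1)) (1 : K)) := by
    have h := (MvPolynomial.basisMonomials (Fin n) K).linearIndependent.comp _
      (injective_shiftExponent (n := n) hτ)
    refine (linearIndependent_equiv' (Equiv.refl _) ?_).mp h
    funext p
    simp [coe_basisMonomials]
  have hker : LinearMap.ker (LinearMap.mulLeft K (C (D : K) : MvPolynomial (Fin n) K)) = ⊥ :=
    LinearMap.ker_eq_bot.mpr fun x y hxy => mul_right_injective₀ (C_ne_zero.mpr hD) hxy
  have h2 := hb.map' _ hker
  refine (linearIndependent_equiv' (Equiv.refl _) ?_).mp h2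
  funext p
  simp only [Function.comp_apply, Equiv.coe_refl, id_eq, LinearMap.mulLeft_apply,
    monomial_mul_pderiv_sumPow, C_mul_monomial, mul_one]

/-- **The ceiling is attained**: `n · #{deg-τ monomials} ≤ rank (F_D)_{(1,·)[τ]}` for `τ + 2 ≤ D`.
[cite: LandsbergGCT2017, §6.2.2 (p. 158)] -/
theorem card_le_shiftedPartialsRank_one_sumPow [CharZero K] {D τ : ℕ} (hτ : τ + 2 ≤ D) :
    n * ((Finset.univ : Finset (Fin n)).finsuppAntidiag τ).card ≤
      shiftedPartialsRank K 1 τ (∑ j : Fin n, (X j : MvPolynomial (Fin n) K) ^ D) := by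
  classical
  set F := (∑ j : Fin n, (X j : MvPolynomial (Fin n) K) ^ D) with hF
  set ψ := fun p : Fin n × ↥((Finset.univ : Finset (Fin n)).finsuppAntidiag τ) =>
      monomial (p.2 : Fin n →₀ ℕ) (1 : K) * pderiv p.1 F with hψ
  have hli : LinearIndependent K ψ := linearIndependent_shifted_sumPow hτ
  haveI := finite_span_shiftedPartials (K := K) 1 τ F
  have hsub : Set.range ψ ⊆ shiftedPartials 1 τ F := by
    rintro _ ⟨⟨i, β, hβ⟩, rfl⟩
    exact ⟨[i], β, rfl, (degree_eq_iff_mem_finsuppAntidiag β τ).mpr hβ, by simp [hψ]⟩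
  unfold shiftedPartialsRank
  calc n * ((Finset.univ : Finset (Fin n)).finsuppAntidiag τ).card
      = Fintype.card (Fin n × ↥((Finset.univ : Finset (Fin n)).finsuppAntidiag τ)) := by
        rw [Fintype.card_prod, Fintype.card_fin, Fintype.card_coe]
    _ = Module.finrank K (Submodule.span K (Set.range ψ)) := (finrank_span_eq_card hli).symm
    _ ≤ Module.finrank K (Submodule.span K (shiftedPartials 1 τ F)) :=
        Submodule.finrank_mono (Submodule.span_mono hsub)

/-- `rank (F_D)_{(1,·)[τ]} = n · #{deg-τ monomials}` exactly, for `τ + 2 ≤ D`.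
[cite: LandsbergGCT2017, §6.2.2 (p. 158)] -/
theorem shiftedPartialsRank_one_sumPow_eq [CharZero K] {D τ : ℕ} (hτ : τ + 2 ≤ D) :
    shiftedPartialsRank K 1 τ (∑ j : Fin n, (X j : MvPolynomial (Fin n) K) ^ D) =
      n * ((Finset.univ : Finset (Fin n)).finsuppAntidiag τ).card :=
  le_antisymm (shiftedPartialsRank_one_le τ _) (card_le_shiftedPartialsRank_one_sumPow hτ)

/-- **Saturation at order one**: for every `g ∈ K[x_1..x_n]` (any degree, homogeneous or not) and
every shift `τ ≤ D - 2`, `rank g_{(1,·)[τ]} ≤ rank (F_D)_{(1,·)[τ]}`.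
[cite: GesmundoLandsberg2017, Thm. 4 and §1] -/
theorem shiftedPartialsRank_one_le_sumPow [CharZero K] {D τ : ℕ} (hτ : τ + 2 ≤ D)
    (g : MvPolynomial (Fin n) K) :
    shiftedPartialsRank K 1 τ g ≤
      shiftedPartialsRank K 1 τ (∑ j : Fin n, (X j : MvPolynomial (Fin n) K) ^ D) :=
  (shiftedPartialsRank_one_le τ g).trans (card_le_shiftedPartialsRank_one_sumPow hτ)

/-! ## §3 The Fermat polynomial is cheap: the wall -/

/-- `deg (Σ_j x_j^D) ≤ D`. [folklore] -/
theorem totalDegree_sumPow_le (D : ℕ) :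
    (∑ j : Fin n, (X j : MvPolynomial (Fin n) K) ^ D).totalDegree ≤ D := by
  refine (totalDegree_finsetSum _ _).trans (Finset.sup_le fun j _ => ?_)
  refine (totalDegree_pow _ _).trans ?_
  rw [totalDegree_X, mul_one]

/-- `L(Σ_j x_j^D) ≤ n·D + n` (`D` multiplications per power, one gate per summand).
[cite: Burgisser2000, §2.1] -/
theorem complexity_sumPow_le (D : ℕ) :
    complexity (∑ j : Fin n, (X j : MvPolynomial (Fin n) K) ^ D) ≤ n * D + n := by
  classical
  refine (complexity_finset_sum_le _ _).trans ?_
  have hp : ∀ j : Fin n, complexity ((X j : MvPolynomial (Fin n) K) ^ D) ≤ D := fun j => by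
    have h := SahaThankey2021.complexity_pow_le (X j : MvPolynomial (Fin n) K) D
    rw [complexity_X_holds (k := K) j, zero_add] at h
    exact h
  calc ∑ j : Fin n, complexity ((X j : MvPolynomial (Fin n) K) ^ D) + (Finset.univ : Finset (Fin n)).card
      ≤ ∑ _j : Fin n, D + (Finset.univ : Finset (Fin n)).card :=
        Nat.add_le_add_right (Finset.sum_le_sum fun j _ => hp j) _
    _ = n * D + n := by simp

/-- `F_{n-1} = Σ_j x_j^{n-1} ∈ SmallCircuits ℂ n b` for `b ≥ 2` (`n(n-1) + n = n² ≤ n^b`).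
[cite: ForbesShpilkaVolk2018, Cor. 5] -/
theorem sumPow_mem_smallCircuits {b : ℕ} (hb : 2 ≤ b) (hn : 1 ≤ n) :
    (∑ j : Fin n, (X j : MvPolynomial (Fin n) ℂ) ^ (n - 1)) ∈ SmallCircuits ℂ n b := by
  refine ⟨(totalDegree_sumPow_le (n - 1)).trans (Nat.sub_le n 1), ?_⟩
  refine (complexity_sumPow_le (n - 1)).trans ?_
  have h1 : n * (n - 1) + n = n ^ 2 := by
    obtain ⟨m, rfl⟩ : ∃ m, n = m + 1 := ⟨n - 1, by omega⟩
    simp [sq]; ring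
  rw [h1]
  exact Nat.pow_le_pow_right hn hb

/-- A first-order threshold set containing the class is everything: if `rank f_{(1,·)[τ]} < r` for
every `f ∈ SmallCircuits ℂ n b` (`n ≥ 3`, `b ≥ 2`, `τ ≤ n - 3`) then `rank g_{(1,·)[τ]} < r` for
EVERY `g`. [cite: GesmundoLandsberg2017, Thm. 4 and §1] -/
theorem sublevel_one_eq_univ_of_smallCircuits {b τ r : ℕ} (hn : 3 ≤ n) (hb : 2 ≤ b)
    (hτ : τ + 3 ≤ n) (h : ∀ f ∈ SmallCircuits ℂ n b, shiftedPartialsRank ℂ 1 τ f < r) :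
    {g : MvPolynomial (Fin n) ℂ | shiftedPartialsRank ℂ 1 τ g < r} = Set.univ := by
  refine Set.eq_univ_of_forall fun g => ?_
  exact lt_of_le_of_lt (shiftedPartialsRank_one_le_sumPow (D := n - 1) (by omega) g)
    (h _ (sumPow_mem_smallCircuits hb (by omega)))

/-- **No first-order shifted-partials rank method against `SmallCircuits`**: for `n ≥ 3`, `b ≥ 2`
and every shift `τ ≤ n - 3` there is no threshold `r` with `rank f_{(1,·)[τ]} < r` on
`SmallCircuits ℂ n b` and `rank g_{(1,·)[τ]} ≥ r` for some polynomial `g` — whatever `g` is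
(any degree, homogeneous or not: the ceiling of §1 is universal). Together with the g10 walls
(order `0 <`… every order at shift `0`; orders `≥ ⌊n/2⌋` at every shift) this leaves exactly the
orders `2 ≤ e < ⌊n/2⌋` with shift `τ ≥ 1`, and order `1` with `τ ≥ n - 2`, unwalled in the kernel.
[cite: ForbesShpilkaVolk2018, Cor. 5] -/
theorem no_shiftedRankMethod_smallCircuits_orderOne {b τ : ℕ} (hn : 3 ≤ n) (hb : 2 ≤ b)
    (hτ : τ + 3 ≤ n) :
    ¬ ∃ r : ℕ, (∀ f ∈ SmallCircuits ℂ n b, shiftedPartialsRank ℂ 1 τ f < r) ∧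
      ∃ g : MvPolynomial (Fin n) ℂ, r ≤ shiftedPartialsRank ℂ 1 τ g := by
  rintro ⟨r, hcls, g, hr⟩
  have hg := (Set.eq_univ_iff_forall.mp (sublevel_one_eq_univ_of_smallCircuits hn hb hτ hcls)) g
  exact absurd hg (not_lt.2 hr)

/-- The linear-size form (the rung `NaturalProofsAgainstAllLinearSizes` uses classes
`{deg ≤ n, L ≤ c·n}`): `F_D` with `D` constant has linear complexity `≤ n·D + n`, so first-order
shifted partials with shift `τ ≤ D - 2` cannot separate even the class `{deg ≤ n, L ≤ (D+1)·n}`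
(`D ≤ n`). [cite: ForbesShpilkaVolk2018, Cor. 5] -/
theorem no_shiftedRankMethod_linearSize_orderOne {D τ : ℕ} (hD : D ≤ n) (hτ : τ + 2 ≤ D) :
    ¬ ∃ r : ℕ, (∀ f : MvPolynomial (Fin n) ℂ, f.totalDegree ≤ n → complexity f ≤ (D + 1) * n →
        shiftedPartialsRank ℂ 1 τ f < r) ∧
      ∃ g : MvPolynomial (Fin n) ℂ, r ≤ shiftedPartialsRank ℂ 1 τ g := by
  rintro ⟨r, hcls, g, hr⟩
  have hF := hcls (∑ j : Fin n, (X j : MvPolynomial (Fin n) ℂ) ^ D)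
    ((totalDegree_sumPow_le D).trans hD) ((complexity_sumPow_le D).trans (by nlinarith))
  exact absurd ((shiftedPartialsRank_one_le_sumPow hτ g).trans_lt hF) (not_lt.2 hr)

end OrderOne

end PartialDerivativeWall

end Summit.ValiantsHypothesis.ValiantsHypothesis.Theorems.BarrierLeverDefinableEquations
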